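import Literature.Analysis.Complex.CauchyTransform
import Mathlib.MeasureTheory.Constructions.HaarToSphere
import Mathlib.MeasureTheory.Measure.Lebesgue.VolumeOfBalls
import HarnessLib

/-!
# Sup-norm bound for the Cauchy transform (Grauert–Remmert, Kap. II §3; Hörmander, Thm. 1.2.2)

The solution `u = T g = K ⋆ g`, `K(t) = 1/(π t)`, of `∂u/∂z̄ = g` by the Cauchy transform
(`Literature.Analysis.Complex.cauchyTransformAlong`, Hörmander (1973), Thm. 1.2.2) satisfies the
elementary sup-norm estimate used by Grauert–Remmert in the Cousin and Cartan Heftungslemmata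
(*Theorie der Steinschen Räume* (1977), Kap. III §1.1, from Kap. II §3: "`|ĥ|_B ≤ 2ρ|h|_B`,
`ρ` = Durchmesser von `E`"):

* `integral_inv_norm_ball` — `∫_{|t| < a} |t|⁻¹ dA(t) = 2πa` (polar coordinates, via Mathlib's
  `integral_fun_norm_addHaar` and `Complex.volume_ball`);
* `norm_cauchyTransformAlong_le` — if along the line `x - ℂ v` the function `g` is bounded by
  `G` and vanishes for `|t| ≥ R`, then `‖(T_v g)(x)‖ ≤ 2 R G`
  (`‖∫ (πt)⁻¹ g(x - tv) dA‖ ≤ G π⁻¹ ∫_{|t|<R} |t|⁻¹ dA = 2RG`).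

## References

* H. Grauert, R. Remmert, *Theorie der Steinschen Räume* (1977), Kap. III §1.1 (proof of Satz 1,
  the estimate `|ĥ|_B ≤ 2ρ|h|_B`) [GrauertRemmert1977].
* L. Hörmander, *An Introduction to Complex Analysis in Several Variables*, 2nd ed. (1973),
  Thm. 1.2.2. [HormanderSCV1973]
-/

noncomputable section

open MeasureTheory Metric Set Real

namespace Literature.Analysis.Complex

variable {E : Type*} [NormedAddCommGroup E] [NormedSpace ℂ E]
  {F : Type*} [NormedAddCommGroup F] [NormedSpace ℂ F]

/-- **`∫_{|t| < a} |t|⁻¹ dA(t) = 2πa`** (polar coordinates: `∫₀ᵃ r⁻¹ · r dr · 2π`). [folklore] -/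
theorem integral_inv_norm_ball {a : ℝ} (ha : 0 ≤ a) :
    ∫ t in ball (0 : ℂ) a, ‖t‖⁻¹ = 2 * π * a := by
  have key := integral_fun_norm_addHaar (E := ℂ) volume
    (fun y : ℝ ↦ (Iio a).indicator (fun y : ℝ ↦ y⁻¹) y)
  have hL : (fun x : ℂ ↦ (Iio a).indicator (fun y : ℝ ↦ y⁻¹) ‖x‖) =
      (ball (0 : ℂ) a).indicator fun x ↦ ‖x‖⁻¹ := by
    funext x
    by_cases hx : ‖x‖ < a
    · rw [indicator_of_mem (mem_Iio.2 hx), indicator_of_mem (mem_ball_zero_iff.2 hx)]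
    · rw [indicator_of_notMem (by simpa using hx),
        indicator_of_notMem (by simpa [mem_ball_zero_iff] using hx)]
  rw [hL, integral_indicator measurableSet_ball] at key
  rw [key, Complex.finrank_real_complex]
  have hvol : (volume : Measure ℂ).real (ball 0 1) = π := by
    simp [Measure.real, Complex.volume_ball]
  have hI : ∫ y in Ioi (0 : ℝ), y ^ (2 - 1) • (Iio a).indicator (fun y : ℝ ↦ y⁻¹) y = a := by
    have h1 : ∀ y ∈ Ioi (0 : ℝ), y ^ (2 - 1) • (Iio a).indicator (fun y : ℝ ↦ y⁻¹) y =
        (Iio a).indicator (fun _ ↦ (1 : ℝ)) y := by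
      intro y hy
      by_cases hya : y < a
      · rw [indicator_of_mem (mem_Iio.2 hya), indicator_of_mem (mem_Iio.2 hya), pow_one,
          smul_eq_mul, mul_inv_cancel₀ (ne_of_gt hy)]
      · rw [indicator_of_notMem (by simpa using hya), indicator_of_notMem (by simpa using hya),
          smul_zero]
    rw [setIntegral_congr_fun measurableSet_Ioi h1, setIntegral_indicator measurableSet_Iio,
      setIntegral_const, Ioi_inter_Iio, Real.volume_real_Ioo, sub_zero, max_eq_left ha,
      smul_eq_mul, mul_one]
  rw [hvol, hI, nsmul_eq_mul, smul_eq_mul, Nat.cast_ofNat, mul_assoc]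

/-- **Sup-norm bound for the Cauchy transform.** If along the line `x - ℂ v` the function `g`
vanishes for `|t| ≥ R` and is bounded by `G`, then `‖(T_v g)(x)‖ ≤ 2 R G`: indeed
`‖∫ (πt)⁻¹ g(x - tv) dA(t)‖ ≤ G π⁻¹ ∫_{|t|<R} |t|⁻¹ dA(t) = 2RG`. With `R` the diameter of the
`z₁`-projection this is Grauert–Remmert's `|ĥ|_B ≤ 2ρ|h|_B`. No integrability hypothesis is needed
(the Bochner integral of a non-integrable function is `0`).
[cite: GrauertRemmert1977, Kap. III §1.1 (proof of Satz 1)] -/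
theorem norm_cauchyTransformAlong_le {g : E → F} {v x : E} {R G : ℝ} (hR : 0 ≤ R) (hG : 0 ≤ G)
    (hsupp : ∀ t : ℂ, g (x - t • v) ≠ 0 → ‖t‖ < R) (hbound : ∀ t : ℂ, ‖g (x - t • v)‖ ≤ G) :
    ‖cauchyTransformAlong v g x‖ ≤ 2 * R * G := by
  rw [cauchyTransformAlong_apply]
  refine (norm_integral_le_integral_norm _).trans ?_
  have hmaj : ∀ t : ℂ, ‖(↑π * t)⁻¹ • g (x - t • v)‖ ≤
      (ball (0 : ℂ) R).indicator (fun t ↦ π⁻¹ * G * ‖t‖⁻¹) t := by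
    intro t
    by_cases ht : g (x - t • v) = 0
    · rw [ht, smul_zero, norm_zero]
      exact indicator_nonneg (fun s _ ↦ by positivity) t
    · rw [indicator_of_mem (mem_ball_zero_iff.2 (hsupp t ht)), norm_smul, norm_inv, norm_mul,
        Complex.norm_real, Real.norm_of_nonneg Real.pi_pos.le, mul_inv]
      calc π⁻¹ * ‖t‖⁻¹ * ‖g (x - t • v)‖ ≤ π⁻¹ * ‖t‖⁻¹ * G := by gcongr; exact hbound t
        _ = π⁻¹ * G * ‖t‖⁻¹ := by ring
  have hint : Integrable ((ball (0 : ℂ) R).indicator fun t ↦ π⁻¹ * G * ‖t‖⁻¹) :=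
    (integrable_indicator_iff measurableSet_ball).2
      ((integrableOn_inv_norm_ball R).const_mul (π⁻¹ * G))
  refine (integral_mono_of_nonneg (Filter.Eventually.of_forall fun t ↦ norm_nonneg _) hint
    (Filter.Eventually.of_forall hmaj)).trans_eq ?_
  rw [integral_indicator measurableSet_ball, integral_const_mul, integral_inv_norm_ball hR]
  field_simp

end Literature.Analysis.Complex

end
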